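import Mathlib
import HarnessLib
import Summits.HubbardSuperconductivity.HubbardSuperconductivity.Theorems.KLProgrammeC4aFirstOrderTubePieceCfgContinuity
import Summits.HubbardSuperconductivity.HubbardSuperconductivity.Theorems.KLProgrammeC4aBubbleTubeRepContinuous
import Summits.HubbardSuperconductivity.HubbardSuperconductivity.Theorems.KLProgrammeC4aCoMovingJetsL1Theta

/-!
# Route `KLProgramme` — crux C4a, S3 brick (B4) «(M₁)-PACKAGE»: the tube piece with joint-`C⁰` kernel data IS a `CoMovingJetsL1Theta 1` vertex — the order-one
# bridge from the zone-box / level-box chain to the (A) capstone's (L3) input, with the level box ITSELF as the `i = 1` dominator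

Cell `gate-hubbard-kl`, seat hubbard-kl-k3c3-p3 (g39; row «implicit-function / monotonicity route for μ(n)»).  Located brick for the (C)-closer lane / the `M₁` assembly
(stub (C) `stub_twoLeg_curvature` of `KLRegimeEngineV17F2`, stmt-HubbardSuperconductivity-20437), base HANDOFF § gen 38 (w96); memo HOME/hubbard-kl-k3c3-p3/SWAP-BY-SYMMETRY.md §6,
K2-FIRST-STEP.md (why the order-one row is the one the |·|-inside interface certifies at natural size).

WHAT.  `…C4aFirstOrderLayerSum.firstOrderLayer_abs_le` and its bumped one-calls bound `∫_{(0,2π]} |LEVEL BOX(θ,ρ,ϑ)| dϑ`, where the level box is the first-order co-moving jet of the tube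
piece (`…C4aFirstOrderTubePieceJoint.norm_deriv_tubePiece_joint_eq`); the (A) capstone `…C4aSliceIncrementAssemblyTheta` consumes `CoMovingJetsL1Theta N a r μ K V` + `∫dϑ a θ i ≤ M_i`.
The missing link (named in `…C4aFirstOrderLayerSum`'s docstring as «the (C)-closer's bridge to `CoMovingJetsL1Theta`'s i = 1 row») is typed here: for the vertex
`V(k,q) = 𝐁_{w⊗w·X}(k+q)` (zone box of a weighted kernel, `…C4aBubbleTubeRepContinuous`) the dominators are THE JETS THEMSELVES — `a θ 0 (ρ,ϑ) = ‖tube piece‖`, `a θ 1 (ρ,ϑ) = |level box|`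
— which are admissible because they are jointly continuous in `(ρ,ϑ)` on the open tube (hence measurable) and uniformly bounded (hence integrable on the chart box):
* (part 1, `…C4aFirstOrderTubePieceCfgContinuity`: joint continuity of value and level box in `(ρ,ϑ)` on the open tube — the measurability half);
* §3 `abs_firstOrderLevelBox_le`, `norm_tubePieceValue_le` — the uniform bounds `2hi·W·2π·J₀·(K₁·2msD₁)·M₁` and `2hi·W·2π·J₀·M₀`;
* §4 **`coMovingJetsL1Theta_one_tubePiece`** (HEADLINE) — `CoMovingJetsL1Theta 1 (fun θ i p => if i = 0 then ‖value θ p‖ else |level box θ p|) r μ K (fun k q => 𝐁_{w⊗w·X}(k+q))`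
  under exactly the kernel rows of `hasDerivAt_tubePiece_joint` for `K e u := w(u)·X(e,u)` and `tsupport w ⊆ (−hi,hi)`.
Sizes binder shape of B-1 (xii); nothing about the model's sizes; nothing asserts (C), K3, the window or superconductivity.
References: BGM 2006 §2.4 (2.36)/(2.40) [cite: BenfattoGiulianiMastropietro2006]; FST II CPAM 51 (1998) §3 Thm 3.5 [cite: FeldmanSalmhoferTrubowitz1998].
-/

noncomputable section

namespace Summit.HubbardSuperconductivity.HubbardSuperconductivity.Theorems.C4a

set_option linter.dupNamespace false -- summit = problem name (single-conjunct summit), D-0017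

open Real Set Filter MeasureTheory intervalIntegral Metric
open scoped Topology Interval
open Literature.MathematicalPhysics.QuantumLattice Literature.MathematicalPhysics.QuantumLattice.BandSectorCounting Literature.Probability.LatticeModels
open Summit.HubbardSuperconductivity.HubbardSuperconductivity.Theorems.KLRegimeSplit
open Summit.HubbardSuperconductivity.HubbardSuperconductivity.Theorems.DispersionFlow
open Summit.HubbardSuperconductivity.HubbardSuperconductivity.Theorems.PerturbedFermiCurve

section Sizes

variable {K : TrigPolyC4v} {A : ℝ} (hA : ∀ p : Momentum, ∀ j ≤ 2, ‖iteratedFDeriv ℝ j (frameShift K) p‖ ≤ A) (hA20 : A ≤ 1 / 20)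
  (hd : klCurveD ≤ (bandBounds (show (-4 : ℝ) < -1.1 by norm_num) (show (-1.1 : ℝ) ≤ -0.1 by norm_num)
    (show (-0.1 : ℝ) < 0 by norm_num)).Dtmin - 2 * A)
  {μ r : ℝ} (hr : 0 < r) (hlo : (-1.1 : ℝ) < μ - r - A) (hhi : μ + r + A < -0.1)
  {A₃ A₄ : ℝ} (hA₃ : ∀ p : Momentum, ‖iteratedFDeriv ℝ 3 (frameShift K) p‖ ≤ A₃)
  (hA₄ : ∀ p : Momentum, ‖iteratedFDeriv ℝ 4 (frameShift K) p‖ ≤ A₄)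
  {K₁ : ℝ} (hK₁ : ∀ p : Momentum, ‖fderiv ℝ (frameLevel μ K) p‖ ≤ K₁)
include hA hA20 hd hr hlo hhi hA₃ hA₄ hK₁

/-! ## §3 Uniform bounds on the open tube -/

omit hA20 hA₃ hA₄ hK₁ hr in
/-- **The tube-piece VALUE is uniformly bounded**: `|f| ≤ W` on `[−hi,hi]`, `|K e u| ≤ M₀` ⟹ `‖∫_{−hi}^{hi} f(e)·(∫_{(−π,π)} J(e,φ+θ)•K e(ē) dφ) de‖ ≤ W·(J₀·M₀·(2π))·(2hi)`,
`J₀ = klJacG Dt_min A A₃ 0`. -/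
theorem norm_tubePieceValue_le {f : ℝ → ℝ} {hi W : ℝ} (hhi0 : 0 ≤ hi) (hhir : hi < r) (hfW : ∀ e ∈ Icc (-hi) hi, |f e| ≤ W)
    {Kr : ℝ → ℝ → ℝ} {M₀ : ℝ} (hK0 : ∀ e ∈ Icc (-hi) hi, ∀ u, |Kr e u| ≤ M₀) (ρ ϑ θ : ℝ) :
    ‖∫ e in (-hi)..hi, ((f e : ℝ) : ℂ) * ∫ φ in Ioo (-π) π,
        (levelChartJac μ K (e, φ + θ) : ℝ) • ((Kr e (frameLevel μ K (levelPoint μ K 0 θ + levelPoint μ K ρ (ϑ + θ) - levelPoint μ K e (φ + θ))) : ℝ) : ℂ)‖ ≤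
      W * (klJacG (bandBounds (show (-4 : ℝ) < -1.1 by norm_num) (show (-1.1 : ℝ) ≤ -0.1 by norm_num) (show (-0.1 : ℝ) < 0 by norm_num)).Dtmin A A₃ 0 * M₀ *
        (2 * π)) * (2 * hi) := by
  set B₀ := bandBounds (show (-4 : ℝ) < -1.1 by norm_num) (show (-1.1 : ℝ) ≤ -0.1 by norm_num) (show (-0.1 : ℝ) < 0 by norm_num) with hB₀
  have hADt : 2 * A < B₀.Dtmin := by have := klCurveD_pos; linarith only [this, hd]
  have hhh : -hi ≤ hi := by linarith only [hhi0]
  have hIcc_r : ∀ e ∈ Icc (-hi) hi, |e| < r := fun e he => abs_lt.2 ⟨by linarith [he.1], lt_of_le_of_lt he.2 hhir⟩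
  have hJ0 : ∀ e ∈ Icc (-hi) hi, ∀ s, |levelChartJac μ K (e, s)| ≤ klJacG B₀.Dtmin A A₃ 0 := fun e he s => by
    have he1 := (abs_lt.1 (hIcc_r e he)).1
    have he2 := (abs_lt.1 (hIcc_r e he)).2
    exact abs_levelChartJac_le' B₀ hA hADt (μ := μ) (ρ := e) (by linarith) (by linarith) A₃ s
  have hJ00 : 0 ≤ klJacG B₀.Dtmin A A₃ 0 := (abs_nonneg _).trans (hJ0 0 ⟨by linarith, hhi0⟩ 0)
  have hM00 : 0 ≤ M₀ := (abs_nonneg _).trans (hK0 0 ⟨by linarith, hhi0⟩ 0)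
  have hW0 : 0 ≤ W := (abs_nonneg _).trans (hfW 0 ⟨by linarith, hhi0⟩)
  have hvol : (volume (Ioo (-π) π)).toReal = 2 * π := by
    rw [Real.volume_Ioo, ENNReal.toReal_ofReal (by linarith [pi_pos])]; ring
  have hinner : ∀ e ∈ Icc (-hi) hi, ‖∫ φ in Ioo (-π) π, (levelChartJac μ K (e, φ + θ) : ℝ) •
      ((Kr e (frameLevel μ K (levelPoint μ K 0 θ + levelPoint μ K ρ (ϑ + θ) - levelPoint μ K e (φ + θ))) : ℝ) : ℂ)‖ ≤
      klJacG B₀.Dtmin A A₃ 0 * M₀ * (2 * π) := fun e he => by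
    have hb : ∀ φ ∈ Ioo (-π) π, ‖(levelChartJac μ K (e, φ + θ) : ℝ) •
        ((Kr e (frameLevel μ K (levelPoint μ K 0 θ + levelPoint μ K ρ (ϑ + θ) - levelPoint μ K e (φ + θ))) : ℝ) : ℂ)‖ ≤
        klJacG B₀.Dtmin A A₃ 0 * M₀ := fun φ _ => by
      rw [norm_smul, Real.norm_eq_abs, Complex.norm_real, Real.norm_eq_abs]
      exact mul_le_mul (hJ0 e he _) (hK0 e he _) (abs_nonneg _) hJ00
    have h := norm_setIntegral_le_of_norm_le_const (measure_Ioo_lt_top : volume (Ioo (-π) π) < ⊤) hb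
    rw [Measure.real, hvol] at h
    exact h
  have hb : ∀ e ∈ Ι (-hi) hi, ‖((f e : ℝ) : ℂ) * ∫ φ in Ioo (-π) π, (levelChartJac μ K (e, φ + θ) : ℝ) •
      ((Kr e (frameLevel μ K (levelPoint μ K 0 θ + levelPoint μ K ρ (ϑ + θ) - levelPoint μ K e (φ + θ))) : ℝ) : ℂ)‖ ≤
      W * (klJacG B₀.Dtmin A A₃ 0 * M₀ * (2 * π)) := fun e he => by
    have he' : e ∈ Icc (-hi) hi := by rw [uIoc_of_le hhh] at he; exact ⟨he.1.le, he.2⟩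
    rw [norm_mul, Complex.norm_real, Real.norm_eq_abs]
    exact mul_le_mul (hfW e he') (hinner e he') (norm_nonneg _) hW0
  have h := intervalIntegral.norm_integral_le_of_norm_le_const hb
  rw [show hi - -hi = 2 * hi by ring, abs_of_nonneg (by linarith : (0 : ℝ) ≤ 2 * hi)] at h
  exact h

/-- **The first-order LEVEL BOX is uniformly bounded on the open tube**: `|f| ≤ W` on `[−hi,hi]`, `|∂ᵤK| ≤ M₁`, `|ρ| < r` ⟹
`|level box| ≤ W·(2π·(J₀·(K₁·(msD₁+msD₁))·M₁))·(2hi)` (the dominated-convergence dominator of `hasDerivAt_tubePiece_joint`, integrated). -/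
theorem abs_firstOrderLevelBox_le {f : ℝ → ℝ} {hi W : ℝ} (hhi0 : 0 ≤ hi) (hhir : hi < r) (hfW : ∀ e ∈ Icc (-hi) hi, |f e| ≤ W)
    {Kr : ℝ → ℝ → ℝ} {M₁ : ℝ} (hK1 : ∀ e ∈ Icc (-hi) hi, ∀ u, |deriv (Kr e) u| ≤ M₁) {ρ : ℝ} (hρ : |ρ| < r) (ϑ θ : ℝ) :
    |∫ e in (-hi)..hi, f e * ∫ v in (-π)..π, levelChartJac μ K (e, v + θ) *
        (fderiv ℝ (frameLevel μ K) (pairSumPath μ K ρ ϑ θ 0 - levelPoint μ K e (v + θ)))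
          (iteratedDeriv 1 (levelPoint μ K 0) θ + iteratedDeriv 1 (levelPoint μ K ρ) (ϑ + θ)) *
        deriv (Kr e) (frameLevel μ K (pairSumPath μ K ρ ϑ θ 0 - levelPoint μ K e (v + θ)))| ≤
      W * (2 * π * (klJacG (bandBounds (show (-4 : ℝ) < -1.1 by norm_num) (show (-1.1 : ℝ) ≤ -0.1 by norm_num) (show (-0.1 : ℝ) < 0 by norm_num)).Dtmin A A₃ 0 *
        (K₁ * (msD A₃ A₄ 1 + msD A₃ A₄ 1)) * M₁)) * (2 * hi) := by
  set B₀ := bandBounds (show (-4 : ℝ) < -1.1 by norm_num) (show (-1.1 : ℝ) ≤ -0.1 by norm_num) (show (-0.1 : ℝ) < 0 by norm_num) with hB₀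
  have hADt : 2 * A < B₀.Dtmin := by have := klCurveD_pos; linarith only [this, hd]
  have hhh : -hi ≤ hi := by linarith only [hhi0]
  have hIcc_r : ∀ e ∈ Icc (-hi) hi, |e| < r := fun e he => abs_lt.2 ⟨by linarith [he.1], lt_of_le_of_lt he.2 hhir⟩
  have h0r : |(0 : ℝ)| < r := by rw [abs_zero]; exact hr
  have hJ0 : ∀ e ∈ Icc (-hi) hi, ∀ s, |levelChartJac μ K (e, s)| ≤ klJacG B₀.Dtmin A A₃ 0 := fun e he s => by
    have he1 := (abs_lt.1 (hIcc_r e he)).1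
    have he2 := (abs_lt.1 (hIcc_r e he)).2
    exact abs_levelChartJac_le' B₀ hA hADt (μ := μ) (ρ := e) (by linarith) (by linarith) A₃ s
  have hS₁ : ‖iteratedDeriv 1 (levelPoint μ K 0) θ + iteratedDeriv 1 (levelPoint μ K ρ) (ϑ + θ)‖ ≤ msD A₃ A₄ 1 + msD A₃ A₄ 1 :=
    (norm_add_le _ _).trans (add_le_add (norm_iteratedDeriv_levelPoint_le hA hA20 hd hlo hhi hA₃ hA₄ h0r le_rfl (by norm_num) θ)
      (norm_iteratedDeriv_levelPoint_le hA hA20 hd hlo hhi hA₃ hA₄ hρ le_rfl (by norm_num) (ϑ + θ)))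
  have hJ00 : 0 ≤ klJacG B₀.Dtmin A A₃ 0 := (abs_nonneg _).trans (hJ0 0 ⟨by linarith, hhi0⟩ 0)
  have hK10 : 0 ≤ K₁ := (norm_nonneg _).trans (hK₁ 0)
  have hS0 : 0 ≤ msD A₃ A₄ 1 + msD A₃ A₄ 1 := (norm_nonneg _).trans hS₁
  have hW0 : 0 ≤ W := (abs_nonneg _).trans (hfW 0 ⟨by linarith, hhi0⟩)
  have hLb : ∀ e ∈ Icc (-hi) hi, |∫ v in (-π)..π, levelChartJac μ K (e, v + θ) *
      (fderiv ℝ (frameLevel μ K) (pairSumPath μ K ρ ϑ θ 0 - levelPoint μ K e (v + θ)))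
        (iteratedDeriv 1 (levelPoint μ K 0) θ + iteratedDeriv 1 (levelPoint μ K ρ) (ϑ + θ)) *
      deriv (Kr e) (frameLevel μ K (pairSumPath μ K ρ ϑ θ 0 - levelPoint μ K e (v + θ)))| ≤
      2 * π * (klJacG B₀.Dtmin A A₃ 0 * (K₁ * (msD A₃ A₄ 1 + msD A₃ A₄ 1)) * M₁) := fun e he => by
    have hb : ∀ v ∈ Ι (-π) π, ‖levelChartJac μ K (e, v + θ) *
        (fderiv ℝ (frameLevel μ K) (pairSumPath μ K ρ ϑ θ 0 - levelPoint μ K e (v + θ)))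
          (iteratedDeriv 1 (levelPoint μ K 0) θ + iteratedDeriv 1 (levelPoint μ K ρ) (ϑ + θ)) *
        deriv (Kr e) (frameLevel μ K (pairSumPath μ K ρ ϑ θ 0 - levelPoint μ K e (v + θ)))‖ ≤
        klJacG B₀.Dtmin A A₃ 0 * (K₁ * (msD A₃ A₄ 1 + msD A₃ A₄ 1)) * M₁ := fun v _ => by
      rw [Real.norm_eq_abs, abs_mul, abs_mul]
      have hG : |(fderiv ℝ (frameLevel μ K) (pairSumPath μ K ρ ϑ θ 0 - levelPoint μ K e (v + θ)))
          (iteratedDeriv 1 (levelPoint μ K 0) θ + iteratedDeriv 1 (levelPoint μ K ρ) (ϑ + θ))| ≤ K₁ * (msD A₃ A₄ 1 + msD A₃ A₄ 1) := by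
        rw [← Real.norm_eq_abs]
        exact (ContinuousLinearMap.le_opNorm _ _).trans (mul_le_mul (hK₁ _) hS₁ (norm_nonneg _) hK10)
      exact mul_le_mul (mul_le_mul (hJ0 e he _) hG (abs_nonneg _) hJ00) (hK1 e he _) (abs_nonneg _) (mul_nonneg hJ00 (mul_nonneg hK10 hS0))
    have h := intervalIntegral.norm_integral_le_of_norm_le_const hb
    rw [Real.norm_eq_abs, show π - -π = 2 * π by ring, abs_of_pos (by positivity : (0 : ℝ) < 2 * π)] at h
    linarith [h]
  have hb : ∀ e ∈ Ι (-hi) hi, ‖f e * ∫ v in (-π)..π, levelChartJac μ K (e, v + θ) *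
      (fderiv ℝ (frameLevel μ K) (pairSumPath μ K ρ ϑ θ 0 - levelPoint μ K e (v + θ)))
        (iteratedDeriv 1 (levelPoint μ K 0) θ + iteratedDeriv 1 (levelPoint μ K ρ) (ϑ + θ)) *
      deriv (Kr e) (frameLevel μ K (pairSumPath μ K ρ ϑ θ 0 - levelPoint μ K e (v + θ)))‖ ≤
      W * (2 * π * (klJacG B₀.Dtmin A A₃ 0 * (K₁ * (msD A₃ A₄ 1 + msD A₃ A₄ 1)) * M₁)) := fun e he => by
    have he' : e ∈ Icc (-hi) hi := by rw [uIoc_of_le hhh] at he; exact ⟨he.1.le, he.2⟩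
    rw [norm_mul, Real.norm_eq_abs, Real.norm_eq_abs]
    exact mul_le_mul (hfW e he') (hLb e he') (abs_nonneg _) hW0
  have h := intervalIntegral.norm_integral_le_of_norm_le_const hb
  rw [Real.norm_eq_abs, show hi - -hi = 2 * hi by ring, abs_of_nonneg (by linarith : (0 : ℝ) ≤ 2 * hi)] at h
  exact h

/-! ## §4 The tube piece as a `CoMovingJetsL1Theta 1` vertex -/

set_option maxHeartbeats 400000 in
/-- **(M₁)-PACKAGE** (HEADLINE).  The zone-box vertex `V(k,q) = 𝐁_{w⊗w·X}(k+q) = ∫_{(−π,π)²} w(e(p̂))·w(e(k+q−p̂))·X(e(p̂), e(k+q−p̂)) dp̂` of a weighted kernel — `w` continuous with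
`tsupport w ⊆ (−hi,hi)`, `0 ≤ hi < r`, `|w| ≤ W`, `X` jointly continuous, and the kernel family `K e u := w(u)·X(e,u)` with the rows of `hasDerivAt_tubePiece_joint` (`C²` in `u`
per level, joint continuity of `∂ᵤK`, `|K| ≤ M₀`, `|∂ᵤK| ≤ M₁`) — carries `CoMovingJetsL1Theta 1 a r μ K V` with THE JETS THEMSELVES as dominators: `a θ 0 (ρ,ϑ) = ‖tube-piece value‖`,
`a θ 1 (ρ,ϑ) = |first-order level box|`.  The `M`-rows `∫_{(0,2π]} a θ i (ρ,·) ≤ M_i` are then exactly the conclusions of `firstOrderLayer_abs_le` (i = 1) and of the value layer.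
[cite: BenfattoGiulianiMastropietro2006, §2.4 (2.36)/(2.40)] -/
theorem coMovingJetsL1Theta_one_tubePiece {w : ℝ → ℝ} (hw : Continuous w) {hi W : ℝ} (hhi0 : 0 ≤ hi) (hhir : hi < r)
    (hwsupp : tsupport w ⊆ Ioo (-hi) hi) (hwW : ∀ e ∈ Icc (-hi) hi, |w e| ≤ W)
    {X : ℝ → ℝ → ℝ} (hX : Continuous fun p : ℝ × ℝ => X p.1 p.2)
    (hKd : ∀ e ∈ Icc (-hi) hi, ContDiff ℝ 2 (fun u : ℝ => w u * X e u))
    (hKc : Continuous fun p : ℝ × ℝ => deriv (fun u : ℝ => w u * X p.1 u) p.2)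
    {M₀ M₁ : ℝ} (hK0 : ∀ e ∈ Icc (-hi) hi, ∀ u, |w u * X e u| ≤ M₀) (hK1 : ∀ e ∈ Icc (-hi) hi, ∀ u, |deriv (fun u : ℝ => w u * X e u) u| ≤ M₁) :
    CoMovingJetsL1Theta 1
      (fun θ i p => if i = 0 then
          ‖∫ e in (-hi)..hi, ((w e : ℝ) : ℂ) * ∫ φ in Ioo (-π) π, (levelChartJac μ K (e, φ + θ) : ℝ) •
            (((w (frameLevel μ K (levelPoint μ K 0 θ + levelPoint μ K p.1 (p.2 + θ) - levelPoint μ K e (φ + θ))) *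
              X e (frameLevel μ K (levelPoint μ K 0 θ + levelPoint μ K p.1 (p.2 + θ) - levelPoint μ K e (φ + θ)))) : ℝ) : ℂ)‖
        else
          |∫ e in (-hi)..hi, w e * ∫ v in (-π)..π, levelChartJac μ K (e, v + θ) *
            (fderiv ℝ (frameLevel μ K) (pairSumPath μ K p.1 p.2 θ 0 - levelPoint μ K e (v + θ)))
              (iteratedDeriv 1 (levelPoint μ K 0) θ + iteratedDeriv 1 (levelPoint μ K p.1) (p.2 + θ)) *
            deriv (fun u : ℝ => w u * X e u) (frameLevel μ K (pairSumPath μ K p.1 p.2 θ 0 - levelPoint μ K e (v + θ)))|)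
      r μ K
      (fun k q => ((∫ p in Ioo (-π) π ×ˢ Ioo (-π) π, w (frameLevel μ K (WithLp.toLp 2 ![p.1, p.2])) *
          w (frameLevel μ K (k + q - WithLp.toLp 2 ![p.1, p.2])) *
          X (frameLevel μ K (WithLp.toLp 2 ![p.1, p.2])) (frameLevel μ K (k + q - WithLp.toLp 2 ![p.1, p.2])) : ℝ) : ℂ)) := by
  set B₀ := bandBounds (show (-4 : ℝ) < -1.1 by norm_num) (show (-1.1 : ℝ) ≤ -0.1 by norm_num) (show (-0.1 : ℝ) < 0 by norm_num) with hB₀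
  have hADt : 2 * A < B₀.Dtmin := by have := klCurveD_pos; linarith only [this, hd]
  have hhh : -hi ≤ hi := by linarith only [hhi0]
  have hfc : ContinuousOn w (Icc (-hi) hi) := hw.continuousOn
  have hKc0 : Continuous fun p : ℝ × ℝ => w p.2 * X p.1 p.2 := (hw.comp continuous_snd).mul hX
  -- the kernel family, named
  obtain ⟨Kr, hKr⟩ : ∃ Kr : ℝ → ℝ → ℝ, Kr = fun e u => w u * X e u := ⟨_, rfl⟩
  have hKd' : ∀ e ∈ Icc (-hi) hi, ContDiff ℝ 2 (Kr e) := by rw [hKr]; exact hKd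
  have hKc0' : Continuous fun p : ℝ × ℝ => Kr p.1 p.2 := by rw [hKr]; exact hKc0
  have hKc' : Continuous fun p : ℝ × ℝ => deriv (Kr p.1) p.2 := by rw [hKr]; exact hKc
  have hK0' : ∀ e ∈ Icc (-hi) hi, ∀ u, |Kr e u| ≤ M₀ := by rw [hKr]; exact hK0
  have hK1' : ∀ e ∈ Icc (-hi) hi, ∀ u, |deriv (Kr e) u| ≤ M₁ := by rw [hKr]; exact hK1
  -- the box has finite measure
  have hfin : volume (Ioo (-r) r ×ˢ Ioc 0 (2 * π)) ≠ ⊤ :=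
    ((Metric.isBounded_Ioo (-r) r).prod (Metric.isBounded_Ioc 0 (2 * π))).measure_lt_top.ne
  have hbox_sub : Ioo (-r) r ×ˢ Ioc 0 (2 * π) ⊆ {x : ℝ | |x| < r} ×ˢ (univ : Set ℝ) :=
    prod_mono (fun x hx => abs_lt.2 ⟨hx.1, hx.2⟩) (subset_univ _)
  have hbox_meas : MeasurableSet (Ioo (-r) r ×ˢ Ioc 0 (2 * π)) := measurableSet_Ioo.prod measurableSet_Ioc
  intro θ
  refine ⟨fun i hi1 => ?_, fun ρ ϑ hρ => ?_⟩
  · -- integrability of the dominators on the chart box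
    rcases Nat.le_one_iff_eq_zero_or_eq_one.1 hi1 with rfl | rfl
    · simp only [↓reduceIte]
      have hcont := (continuousOn_tubePieceValue_cfg hA hd hlo hhi θ hhi0 hhir hfc hKc0').mono hbox_sub
      have hmeas := (hcont.norm).aestronglyMeasurable (μ := volume) hbox_meas
      simp only [hKr] at hmeas
      refine Integrable.mono' (integrableOn_const (C := W * (klJacG B₀.Dtmin A A₃ 0 * M₀ * (2 * π)) * (2 * hi)) hfin) hmeas ?_
      refine (ae_restrict_iff' hbox_meas).2 (Eventually.of_forall fun p hp => ?_)
      rw [norm_norm]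
      have h := norm_tubePieceValue_le hA hd hlo hhi (A₃ := A₃) hhi0 hhir hwW hK0' p.1 p.2 θ
      simp only [hKr] at h
      exact h
    · simp only [one_ne_zero, ↓reduceIte]
      have hcont := (continuousOn_firstOrderLevelBox_cfg hA hd hlo hhi θ hhi0 hhir hfc hKc').mono hbox_sub
      have hmeas := (continuous_abs.comp_continuousOn hcont).aestronglyMeasurable (μ := volume) hbox_meas
      simp only [hKr, Function.comp_def] at hmeas
      refine Integrable.mono' (integrableOn_const (C := W * (2 * π * (klJacG B₀.Dtmin A A₃ 0 * (K₁ * (msD A₃ A₄ 1 + msD A₃ A₄ 1)) * M₁)) * (2 * hi)) hfin) hmeas ?_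
      refine (ae_restrict_iff' hbox_meas).2 (Eventually.of_forall fun p hp => ?_)
      rw [Real.norm_eq_abs, abs_abs]
      have hρ : |p.1| < r := abs_lt.2 ⟨(mem_prod.1 hp).1.1, (mem_prod.1 hp).1.2⟩
      have h := abs_firstOrderLevelBox_le hA hA20 hd hr hlo hhi hA₃ hA₄ hK₁ hhi0 hhir hwW hK1' hρ p.2 θ
      simp only [hKr] at h
      exact h
  · -- smoothness and the jets at one configuration
    have hC1 := contDiff_one_tubePiece_joint hA hA20 hd hr hlo hhi hA₃ hA₄ hK₁ hhi0 hhir hfc hwW hKd' hKc0' hKc' hK0' hK1' hρ ϑ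
    have hnd := norm_deriv_tubePiece_joint_eq hA hA20 hd hr hlo hhi hA₃ hA₄ hK₁ hhi0 hhir hfc hwW hKd' hKc0' hKc' hK0' hK1' hρ ϑ θ
    simp only [hKr] at hC1 hnd
    -- the tube piece as a function of the base angle, at this configuration
    obtain ⟨F, hFdef⟩ : ∃ F : ℝ → ℂ, F = fun θ' : ℝ => ∫ e in (-hi)..hi, ((w e : ℝ) : ℂ) * ∫ φ in Ioo (-π) π, (levelChartJac μ K (e, φ + θ') : ℝ) •
        (((w (frameLevel μ K (levelPoint μ K 0 θ' + levelPoint μ K ρ (ϑ + θ') - levelPoint μ K e (φ + θ'))) *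
          X e (frameLevel μ K (levelPoint μ K 0 θ' + levelPoint μ K ρ (ϑ + θ') - levelPoint μ K e (φ + θ')))) : ℝ) : ℂ) := ⟨_, rfl⟩
    have hco : coMoving μ K (fun k q => ((∫ p in Ioo (-π) π ×ˢ Ioo (-π) π, w (frameLevel μ K (WithLp.toLp 2 ![p.1, p.2])) *
          w (frameLevel μ K (k + q - WithLp.toLp 2 ![p.1, p.2])) *
          X (frameLevel μ K (WithLp.toLp 2 ![p.1, p.2])) (frameLevel μ K (k + q - WithLp.toLp 2 ![p.1, p.2])) : ℝ) : ℂ)) θ ρ (ϑ + θ) =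
        fun t : ℝ => F (θ + t) := by
      funext t
      have hS : levelPoint μ K 0 (θ + t) + levelPoint μ K ρ (ϑ + θ + t) = pairSumPath μ K ρ ϑ (θ + t) 0 := by
        simp only [pairSumPath, add_zero, add_assoc]
      simp only [coMoving, hFdef]
      rw [hS, zoneBox_weightedKernel_pairSum_eq_tubePiece B₀ hA hADt hlo hhi hw hhi0 hhir hwsupp hX ρ ϑ (θ + t)]
    have hFC1 : ContDiff ℝ 1 F := by rw [hFdef]; exact hC1
    have hshift : ContDiff ℝ 1 fun t : ℝ => θ + t := contDiff_const.add contDiff_id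
    refine ⟨by rw [hco]; exact hFC1.comp hshift, fun i hi1 => ?_⟩
    rcases Nat.le_one_iff_eq_zero_or_eq_one.1 hi1 with rfl | rfl
    · rw [iteratedDeriv_zero, hco]
      simp only [↓reduceIte, add_zero, hFdef, le_refl]
    · rw [iteratedDeriv_one, hco, deriv_comp_const_add, add_zero]
      simp only [one_ne_zero, ↓reduceIte]
      rw [hFdef, hnd]

end Sizes

end Summit.HubbardSuperconductivity.HubbardSuperconductivity.Theorems.C4a

end
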